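import Summits.ResolutionOfSingularities.ResolutionOfSingularities.Theorems.FrobeniusLadderFInjectiveMacaulayficationOfPointFixable
import Summits.ResolutionOfSingularities.ResolutionOfSingularities.Theorems.FrobeniusLadderFInjectiveMacaulayficationT11PlusOffStratum
import Summits.ResolutionOfSingularities.ResolutionOfSingularities.Theorems.FrobeniusLadderFInjectiveMacaulayficationT11PlusPrime
import Summits.ResolutionOfSingularities.ResolutionOfSingularities.Theorems.FrobeniusLadderFInjectiveMacaulayficationClauseOfMaximal
import Summits.ResolutionOfSingularities.ResolutionOfSingularities.Theorems.FrobeniusLadderFInjectiveMacaulayficationCIFedderAtMaximalIdeal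
import Summits.ResolutionOfSingularities.ResolutionOfSingularities.Theorems.FrobeniusLadderFInjectiveMacaulayficationCIChartCore
import Summits.ResolutionOfSingularities.ResolutionOfSingularities.Theorems.FrobeniusLadderFInjectiveMacaulayficationFiLocusOpenOfAffine
import Summits.ResolutionOfSingularities.ResolutionOfSingularities.Theorems.FrobeniusLadderFInjectiveMacaulayficationDegreeZeroDescentLocal
import Summits.ResolutionOfSingularities.ResolutionOfSingularities.Theorems.FrobeniusLadderFInjectiveMacaulayficationFedderOrigin
import Literature.AlgebraicGeometry.Resolution.RegularLocalRingsQuotient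
import Mathlib.RingTheory.Jacobson.Ring
import Mathlib.Algebra.MvPolynomial.PDeriv
import HarnessLib

/-!
# The `T₁₁⁺` specimen door: an F-injective Macaulayfication of `V(Φ−y²−x³, z²+Φ³+x¹¹+w⁷) ⊂ 𝔸⁵`, `p = 7`,
# from point-fixability of its one non-F-injective stalk (crux `FInjectiveMacaulayfication`, K-T4 Lean half)

Support file for crux stmt-ResolutionOfSingularities-15315 (`FrobeniusLadder.FInjectiveMacaulayfication`), chain w45a,
seat res-L1-w45a-stub-3 (res-L1-w45a-plan-1 RULING R12.15: "T11SpecimenDoor"). [OURS · L1 W4.5a] — produced inside this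
programme; reviewed only by AI agents (AI review is weaker than expert human review).

The specimen is `X = Spec R`, `R = k[x,y,z,w,Φ]/(F₀, F₁)` with `F₀ = Φ − y² − x³`, `F₁ = z² + Φ³ + x¹¹ + w⁷`
(`Fs : Fin 2 → k[X₀,…,X₄]`, `x = X 0`, `y = X 1`, `z = X 2`, `w = X 3`, `Φ = X 4`), `char k = 7`; it is a
three-dimensional complete-intersection domain (`T11PlusPrime.t11plus_prime_and_X_ne_zero`). This file reduces the
crux conclusion for `X` — a proper birational `X' → X` all of whose stalks are Cohen–Macaulay F-injective domains — to
ONE local statement at the origin `𝔪 = (x̄, ȳ, z̄, w̄, Φ̄)`: point-fixability of the stalk `𝒪_{X,0}` in the sense of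
`OfPointFixable.fInjectiveMacaulayfication_of_pointFixable` (a finite family `c` in the stalk generating an
`𝔪`-primary ideal whose affine blow-up algebras satisfy the clause over the closed point).

## The argument

* §1 `fiClause_atPrime_of_ne_origin`: at every prime `P ≠ 𝔪` of `R` the local ring `R_P` is a domain satisfying the
  per-stalk clause (Cohen–Macaulay + Frobenius-closed parameter ideals, `p = 7`). Three regimes:
  `x̄ ∉ P` — `R` is Jacobson, so `P ⊆ Q` for a maximal `Q ∌ x̄`, where the clause is stub-4's
  `T11PlusOffStratum.t11Plus_hoff_char7` (Fedder), and the clause descends to `P` (`ClauseOfMaximal.fiClause_atPrime_of_le`);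
  `x̄ ∈ P ∌ Φ̄` — `T11PlusOffStratum.clause_of_x_mem_P_not_mem` (Jacobian minor `−6yΦ²`);
  `x̄, Φ̄ ∈ P ≠ 𝔪` — then `ȳ ∈ P` and `z̄ ∉ P` (else `w̄⁷ ∈ P` and `P = 𝔪`), and the `(z, Φ)`-minor `−2z` of the
  Jacobian is a unit at `P` (`CIJacobian.ci_clause_of_det_not_mem`).
* §2 `cmClause_of_isMaximal`: at every maximal ideal (in particular at `𝔪`) the local ring is Cohen–Macaulay — a
  complete intersection of the expected dimension in a regular local ring (`T11PlusOffStratum.ringKrullDim_stalk_add_two`,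
  `CIChartCore.sop_isWeaklyRegular_quotient_ofList`).
* §3 `fInjectiveMacaulayfication_T11plus_char7`: the door. `Spec R → Spec k` is separated, quasi-compact and locally
  of finite type, `Spec R` is integral, every stalk is Cohen–Macaulay (§1, §2), the non-F-injective locus is contained in
  `{𝔪}` (§1), hence finite, and the hypothesis supplies point-fixability there; `OfPointFixable.fInjectiveMacaulayfication_of_pointFixable`
  (A-loc, p512322) assembles the model. Stalks of `Spec R` are moved to `Localization.AtPrime` along `Spec.stalkIso`
  (`DegreeZeroDescent.inlineClause_of_ringEquiv`, `FiLocusOpenOfAffine.cmClause_of_ringEquiv`).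

[cite: Fedder1983, Prop. 2.1; Matsumura1987, Thm. 30.4 (ii), Thm. 17.4, Thm. 21.2] for the local algebra; the assembly is
this chain's (A-loc). No new definitions; no `sorry`; classical axioms only.
-/

namespace Summit.ResolutionOfSingularities.ResolutionOfSingularities.Theorems.FInjectiveMacaulayfication.T11SpecimenDoor

open AlgebraicGeometry CategoryTheory MvPolynomial IsLocalRing Literature.AlgebraicGeometry.Resolution
open Summit.ResolutionOfSingularities.ResolutionOfSingularities.Theorems.FInjectiveMacaulayfication

variable (k : Type) [Field k]

/-! ## §1 The clause at the primes other than the origin -/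

/-- **Jacobson step**: in `R = k[X]/(Fs)` (a Jacobson ring) a prime `P` missing an element `t` lies in a maximal
ideal missing `t`. [folklore] -/
theorem exists_isMaximal_not_mem (Fs : Fin 2 → MvPolynomial (Fin 5) k)
    (P : Ideal (MvPolynomial (Fin 5) k ⧸ Ideal.span (Set.range Fs))) [P.IsPrime] (t : (MvPolynomial (Fin 5) k ⧸ Ideal.span (Set.range Fs))) (ht : t ∉ P) :
    ∃ Q : Ideal (MvPolynomial (Fin 5) k ⧸ Ideal.span (Set.range Fs)), Q.IsMaximal ∧ P ≤ Q ∧ t ∉ Q := by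
  by_contra hcon
  push Not at hcon
  apply ht
  have hJ : P.jacobson = P := IsJacobsonRing.out inferInstance (Ideal.IsPrime.isRadical ‹_›)
  rw [← hJ, Ideal.jacobson, Ideal.mem_sInf]
  rintro Q ⟨hPQ, hQ⟩
  exact hcon Q hQ hPQ

/-- **A prime of `R = k[x,y,z,w,Φ]/(Φ−y²−x³, z²+Φ³+x¹¹+w⁷)` containing `x̄, z̄, Φ̄` contains every variable**:
`ȳ² = Φ̄ − x̄³ ∈ P` and `w̄⁷ = −(z̄² + Φ̄³ + x̄¹¹) ∈ P`. [folklore] -/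
theorem mk_X_mem_of_mem (Fs : Fin 2 → MvPolynomial (Fin 5) k)
    (hF₀ : Fs 0 = X 4 - X 1 ^ 2 - X 0 ^ 3) (hF₁ : Fs 1 = X 2 ^ 2 + X 4 ^ 3 + X 0 ^ 11 + X 3 ^ 7)
    (P : Ideal (MvPolynomial (Fin 5) k ⧸ Ideal.span (Set.range Fs))) [P.IsPrime]
    (h0 : Ideal.Quotient.mk (Ideal.span (Set.range Fs)) (X 0) ∈ P) (h2 : Ideal.Quotient.mk (Ideal.span (Set.range Fs)) (X 2) ∈ P) (h4 : Ideal.Quotient.mk (Ideal.span (Set.range Fs)) (X 4) ∈ P) :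
    ∀ j : Fin 5, Ideal.Quotient.mk (Ideal.span (Set.range Fs)) (X j) ∈ P := by
  have hF : ∀ i, Ideal.Quotient.mk (Ideal.span (Set.range Fs)) (Fs i) = 0 := fun i =>
    Ideal.Quotient.eq_zero_iff_mem.mpr (Ideal.subset_span (Set.mem_range_self i))
  have h1 : Ideal.Quotient.mk (Ideal.span (Set.range Fs)) (X 1) ∈ P := by
    apply Ideal.IsPrime.mem_of_pow_mem ‹P.IsPrime› 2
    have h : Ideal.Quotient.mk (Ideal.span (Set.range Fs)) (X 1) ^ 2 = Ideal.Quotient.mk (Ideal.span (Set.range Fs)) (X 4) - Ideal.Quotient.mk (Ideal.span (Set.range Fs)) (X 0) ^ 3 - Ideal.Quotient.mk (Ideal.span (Set.range Fs)) (Fs 0) := by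
      simp only [hF₀, map_sub, map_pow]; ring
    rw [h, hF 0, sub_zero]
    exact sub_mem h4 (Ideal.pow_mem_of_mem P h0 3 (by norm_num))
  have h3 : Ideal.Quotient.mk (Ideal.span (Set.range Fs)) (X 3) ∈ P := by
    apply Ideal.IsPrime.mem_of_pow_mem ‹P.IsPrime› 7
    have h : Ideal.Quotient.mk (Ideal.span (Set.range Fs)) (X 3) ^ 7 = Ideal.Quotient.mk (Ideal.span (Set.range Fs)) (Fs 1) - (Ideal.Quotient.mk (Ideal.span (Set.range Fs)) (X 2) ^ 2 + Ideal.Quotient.mk (Ideal.span (Set.range Fs)) (X 4) ^ 3 + Ideal.Quotient.mk (Ideal.span (Set.range Fs)) (X 0) ^ 11) := by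
      simp only [hF₁, map_add, map_pow]; ring
    rw [h, hF 1, zero_sub]
    exact neg_mem (add_mem (add_mem (Ideal.pow_mem_of_mem P h2 2 (by norm_num))
      (Ideal.pow_mem_of_mem P h4 3 (by norm_num))) (Ideal.pow_mem_of_mem P h0 11 (by norm_num)))
  intro j
  fin_cases j
  exacts [h0, h1, h2, h3, h4]

/-- **The Jacobian regime `x̄, Φ̄ ∈ P`, `z̄ ∉ P`**: the `(z, Φ)`-minor of the Jacobian of `(F₀, F₁)` is
`0 · 3Φ² − 2z · 1 = −2z ∉ P`, so `R_P` is a regular local ring, hence a domain satisfying the clause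
(stub-6's `CIJacobian.ci_clause_of_det_not_mem`). [cite: Matsumura1987, Thm. 30.4 (ii)] -/
theorem fiClause_of_z_not_mem [CharP k 7] (Fs : Fin 2 → MvPolynomial (Fin 5) k)
    (hF₀ : Fs 0 = X 4 - X 1 ^ 2 - X 0 ^ 3) (hF₁ : Fs 1 = X 2 ^ 2 + X 4 ^ 3 + X 0 ^ 11 + X 3 ^ 7)
    (P : Ideal (MvPolynomial (Fin 5) k ⧸ Ideal.span (Set.range Fs))) [P.IsPrime] (hz : Ideal.Quotient.mk (Ideal.span (Set.range Fs)) (X 2) ∉ P) :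
    IsDomain (Localization.AtPrime P) ∧
      ∀ d : ℕ, ringKrullDim (Localization.AtPrime P) = d → ∀ s : Fin d → Localization.AtPrime P, (Ideal.span (Set.range s)).radical.IsMaximal →
        RingTheory.Sequence.IsWeaklyRegular (Localization.AtPrime P) (List.ofFn s) ∧
        ∀ y : Localization.AtPrime P, (∃ e : ℕ, y ^ 7 ^ e ∈ Ideal.span ((fun z : Localization.AtPrime P => z ^ 7 ^ e) ''
          (Ideal.span (Set.range s) : Set (Localization.AtPrime P)))) → y ∈ Ideal.span (Set.range s) := by
  haveI : Fact (Nat.Prime 7) := ⟨by norm_num⟩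
  set P₀ := P.comap (Ideal.Quotient.mk (Ideal.span (Set.range Fs))) with hP₀def
  haveI : P₀.IsPrime := Ideal.comap_isPrime _ _
  have hzP : (X 2 : MvPolynomial (Fin 5) k) ∉ P₀ := fun h => hz (Ideal.mem_comap.mp h)
  -- the derivations `∂_z`, `∂_Φ` and the minor
  let D : Fin 2 → Derivation ℤ (MvPolynomial (Fin 5) k) (MvPolynomial (Fin 5) k) :=
    ![(pderiv 2).restrictScalars ℤ, (pderiv 4).restrictScalars ℤ]
  have hdet : (Matrix.of fun i j => D i (Fs j)).det = C (-2) * X 2 := by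
    rw [Matrix.det_fin_two]
    simp only [D, Matrix.of_apply, Matrix.cons_val_zero, Matrix.cons_val_one, Derivation.restrictScalars_apply, hF₀, hF₁,
      map_add, map_sub, Derivation.leibniz_pow, pderiv_X_self, pderiv_X_of_ne (show (4 : Fin 5) ≠ 2 by decide),
      pderiv_X_of_ne (show (0 : Fin 5) ≠ 2 by decide), pderiv_X_of_ne (show (1 : Fin 5) ≠ 2 by decide),
      pderiv_X_of_ne (show (3 : Fin 5) ≠ 2 by decide), pderiv_X_of_ne (show (1 : Fin 5) ≠ 4 by decide),
      pderiv_X_of_ne (show (0 : Fin 5) ≠ 4 by decide), pderiv_X_of_ne (show (2 : Fin 5) ≠ 4 by decide),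
      pderiv_X_of_ne (show (3 : Fin 5) ≠ 4 by decide), smul_eq_mul, mul_one, nsmul_eq_mul, map_neg, map_ofNat]
    norm_num
  have h2 : (-2 : k) ≠ 0 := by
    intro h
    have h' : ((2 : ℕ) : k) = 0 := by
      have : (2 : k) = 0 := by linear_combination -h
      exact_mod_cast this
    rw [CharP.cast_eq_zero_iff k 7] at h'
    omega
  have hndet : (Matrix.of fun i j => D i (Fs j)).det ∉ P₀ := by
    rw [hdet]
    intro h
    rcases (Ideal.IsPrime.mem_or_mem ‹P₀.IsPrime› h) with h1 | h1
    · exact (Ideal.IsPrime.ne_top ‹P₀.IsPrime›) (Ideal.eq_top_of_isUnit_mem _ h1 ((isUnit_iff_ne_zero.mpr h2).map C))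
    · exact hzP h1
  have H := CIJacobian.ci_clause_of_det_not_mem 7 k 5 2 Fs P D hndet
  exact ⟨H.2.1, H.2.2.1⟩

/-- **§1 THE CLAUSE OFF THE ORIGIN**: for every prime `P` of `R = k[x,y,z,w,Φ]/(Φ−y²−x³, z²+Φ³+x¹¹+w⁷)`, `char k = 7`,
missing some variable, `R_P` is a domain all of whose systems of parameters are weakly regular and generate Frobenius
closed ideals. (`x̄ ∉ P`: Jacobson + `T11PlusOffStratum.t11Plus_hoff_char7` at a maximal `Q ⊇ P` missing `x̄` +
`ClauseOfMaximal.fiClause_atPrime_of_le`; `x̄ ∈ P ∌ Φ̄`: `T11PlusOffStratum.clause_of_x_mem_P_not_mem`; `x̄, Φ̄ ∈ P`: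
`z̄ ∉ P` by `mk_X_mem_of_mem`, then `fiClause_of_z_not_mem`.) [cite: Fedder1983, Prop. 2.1; Matsumura1987, Thm. 30.4 (ii)] -/
theorem fiClause_atPrime_of_ne_origin [CharP k 7] (Fs : Fin 2 → MvPolynomial (Fin 5) k)
    (hF₀ : Fs 0 = X 4 - X 1 ^ 2 - X 0 ^ 3) (hF₁ : Fs 1 = X 2 ^ 2 + X 4 ^ 3 + X 0 ^ 11 + X 3 ^ 7)
    (P : Ideal (MvPolynomial (Fin 5) k ⧸ Ideal.span (Set.range Fs))) [P.IsPrime] (hP : ∃ j : Fin 5, Ideal.Quotient.mk (Ideal.span (Set.range Fs)) (X j) ∉ P) :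
    IsDomain (Localization.AtPrime P) ∧
      ∀ d : ℕ, ringKrullDim (Localization.AtPrime P) = d → ∀ s : Fin d → Localization.AtPrime P, (Ideal.span (Set.range s)).radical.IsMaximal →
        RingTheory.Sequence.IsWeaklyRegular (Localization.AtPrime P) (List.ofFn s) ∧
        ∀ y : Localization.AtPrime P, (∃ e : ℕ, y ^ 7 ^ e ∈ Ideal.span ((fun z : Localization.AtPrime P => z ^ 7 ^ e) ''
          (Ideal.span (Set.range s) : Set (Localization.AtPrime P)))) → y ∈ Ideal.span (Set.range s) := by
  haveI : Fact (Nat.Prime 7) := ⟨by norm_num⟩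
  haveI : (Ideal.span (Set.range Fs)).IsPrime := (T11PlusPrime.t11plus_prime_and_X_ne_zero k Fs hF₀ hF₁).1
  haveI : IsDomain (MvPolynomial (Fin 5) k ⧸ Ideal.span (Set.range Fs)) := Ideal.Quotient.isDomain _
  haveI : CharP (MvPolynomial (Fin 5) k ⧸ Ideal.span (Set.range Fs)) 7 := charP_of_injective_algebraMap (algebraMap k (MvPolynomial (Fin 5) k ⧸ Ideal.span (Set.range Fs))).injective 7
  have hdom : ∀ (Q : Ideal (MvPolynomial (Fin 5) k ⧸ Ideal.span (Set.range Fs))) [Q.IsPrime], IsDomain (Localization.AtPrime Q) := fun Q _ =>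
    IsLocalization.isDomain_localization Q.primeCompl_le_nonZeroDivisors
  by_cases hx : Ideal.Quotient.mk (Ideal.span (Set.range Fs)) (X 0) ∈ P
  · by_cases hΦ : Ideal.Quotient.mk (Ideal.span (Set.range Fs)) (X 4) ∈ P
    · -- `x̄, Φ̄ ∈ P`: then `z̄ ∉ P`
      have hz : Ideal.Quotient.mk (Ideal.span (Set.range Fs)) (X 2) ∉ P := by
        intro hz
        obtain ⟨j, hj⟩ := hP
        exact hj (mk_X_mem_of_mem k Fs hF₀ hF₁ P hx hz hΦ j)
      exact fiClause_of_z_not_mem k Fs hF₀ hF₁ P hz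
    · -- `x̄ ∈ P`, `Φ̄ ∉ P`
      exact ⟨hdom P, T11PlusOffStratum.clause_of_x_mem_P_not_mem Fs hF₀ hF₁ P (Ideal.mem_comap.mpr hx)
        (fun h => hΦ (Ideal.mem_comap.mp h))⟩
  · -- `x̄ ∉ P`: a maximal `Q ⊇ P` missing `x̄`
    obtain ⟨Q, hQ, hPQ, hxQ⟩ := exists_isMaximal_not_mem k Fs P _ hx
    haveI := hQ
    have hclQ := T11PlusOffStratum.t11Plus_hoff_char7 k Fs hF₀ hF₁ Q ⟨0, by simp, hxQ⟩
    exact ClauseOfMaximal.fiClause_atPrime_of_le 7 hPQ ⟨hdom Q, hclQ⟩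

/-! ## §2 Cohen–Macaulayness at the closed points -/

/-- **§2 THE LOCAL RINGS AT THE CLOSED POINTS ARE COHEN–MACAULAY**: for every maximal ideal `Q` of
`k[X]/(F₁, F₂)` (presented by a set `s = {F₁, F₂}` of generators), every system of parameters of the local ring at `Q`
is weakly regular — a complete intersection of the expected dimension `3 = 5 − 2`
(`T11PlusOffStratum.ringKrullDim_stalk_add_two`) in the regular local ring `k[X]_{Q ∩ k[X]}`
(`CIChartCore.sop_isWeaklyRegular_quotient_ofList`, transported along `k[X]_P/(F) ≅ (k[X]/(F))_Q`). No characteristic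
hypothesis. [cite: Matsumura1987, Thm. 17.4 and Thm. 21.2] -/
theorem cmClause_of_isMaximal {k : Type} [Field k] (F₁ F₂ : MvPolynomial (Fin 5) k)
    (hF₁ : F₁ = X 4 - X 1 ^ 2 - X 0 ^ 3) (hF₂ : F₂ = X 2 ^ 2 + X 4 ^ 3 + X 0 ^ 11 + X 3 ^ 7)
    (s : Set (MvPolynomial (Fin 5) k)) (hs : s = {r : MvPolynomial (Fin 5) k | r ∈ [F₁, F₂]})
    (Q : Ideal (MvPolynomial (Fin 5) k ⧸ Ideal.span s)) (hQ : Q.IsMaximal) :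
    ∀ d : ℕ, ringKrullDim (Localization.AtPrime Q) = d → ∀ s : Fin d → Localization.AtPrime Q, (Ideal.span (Set.range s)).radical.IsMaximal →
        RingTheory.Sequence.IsWeaklyRegular (Localization.AtPrime Q) (List.ofFn s) := by
  subst hs
  change Ideal (MvPolynomial (Fin 5) k ⧸ Ideal.ofList [F₁, F₂]) at Q
  haveI := hQ
  haveI hPmax : (Q.comap (Ideal.Quotient.mk (Ideal.ofList [F₁, F₂]))).IsMaximal :=
    Ideal.comap_isMaximal_of_surjective _ Ideal.Quotient.mk_surjective
  set P : Ideal (MvPolynomial (Fin 5) k) := Q.comap (Ideal.Quotient.mk (Ideal.ofList [F₁, F₂])) with hP_def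
  set R := Localization.AtPrime P
  haveI : IsRegularLocalRing R := IsRegularRing.isRegularLocalRing_localization P
  have hdimR : ringKrullDim R = ((5 : ℕ) : WithBot ℕ∞) := by
    rw [IsLocalization.AtPrime.ringKrullDim_eq_height P R, MvPolynomial.height_eq_of_isMaximal k 5 P]
    rfl
  -- the local equations upstairs
  set gs' : List R := [F₁, F₂].map (algebraMap (MvPolynomial (Fin 5) k) R) with hgs'_def
  have hgsP : ∀ g ∈ [F₁, F₂], g ∈ P := by
    intro g hg
    rw [hP_def, Ideal.mem_comap,
      Ideal.Quotient.eq_zero_iff_mem.mpr (Ideal.subset_span (show g ∈ {r | r ∈ [F₁, F₂]} from hg))]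
    exact Q.zero_mem
  have hgs'm : ∀ g ∈ gs', g ∈ maximalIdeal R := by
    intro g hg
    obtain ⟨g₀, hg₀, rfl⟩ := List.mem_map.mp hg
    rw [← IsLocalization.AtPrime.map_eq_maximalIdeal P R]
    exact Ideal.mem_map_of_mem _ (hgsP g₀ hg₀)
  -- `R ⧸ (gs') ≅ (S ⧸ (gs))_Q`
  have hmap : Ideal.ofList gs' = (Ideal.ofList [F₁, F₂]).map (algebraMap (MvPolynomial (Fin 5) k) R) := by
    rw [hgs'_def, Ideal.map_ofList]
  obtain ⟨e₀⟩ := CIFedderAtMaximalIdeal.nonempty_quotLocalizationEquiv (MvPolynomial (Fin 5) k) (Ideal.ofList [F₁, F₂]) Q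
  have e₁ : (R ⧸ Ideal.ofList gs') ≃+* Localization.AtPrime Q := (Ideal.quotEquivOfEq hmap).trans e₀
  -- dimension bookkeeping: `dim (S⧸(F))_Q = 3`
  obtain ⟨e, he⟩ := exists_nat_cast_eq_ringKrullDim (R := Localization.AtPrime Q)
  have hadd := T11PlusOffStratum.ringKrullDim_stalk_add_two F₁ F₂ hF₁ hF₂ Q
  rw [he] at hadd
  have he3 : e = 3 := by
    have h' : ((e + [F₁, F₂].length : ℕ) : WithBot ℕ∞) = ((5 : ℕ) : WithBot ℕ∞) := by
      rw [← hadd]; push_cast; rfl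
    have h'' : e + [F₁, F₂].length = 5 := by exact_mod_cast h'
    simpa using h''
  subst he3
  have hquot : ringKrullDim (R ⧸ Ideal.ofList gs') = ((3 : ℕ) : WithBot ℕ∞) := by
    rw [ringKrullDim_eq_of_ringEquiv e₁, he]
  have hdim : ringKrullDim R = ((gs'.length + 3 : ℕ) : WithBot ℕ∞) := by
    rw [hdimR, hgs'_def]; rfl
  exact FiLocusOpenOfAffine.cmClause_of_ringEquiv (A := R ⧸ Ideal.ofList gs') (B := Localization.AtPrime Q) e₁
    (CIChartCore.sop_isWeaklyRegular_quotient_ofList gs' hgs'm 3 hdim hquot)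

/-! ## §3 The door -/

/-- **THE `T₁₁⁺` SPECIMEN DOOR, `char k = 7`.** Let `R = k[x,y,z,w,Φ]/(F₀, F₁)`, `F₀ = Φ − y² − x³`,
`F₁ = z² + Φ³ + x¹¹ + w⁷` (`Fs 0 = F₀`, `Fs 1 = F₁`), `X = Spec R`. If the stalk of `X` at the origin
`𝔪 = (x̄, ȳ, z̄, w̄, Φ̄)` is point-fixable — there is a finite family `c` in `𝒪_{X,𝔪}` generating a nonzero ideal with
radical the maximal ideal such that every prime of every affine blow-up algebra `𝒪_{X,𝔪}[(c)/c_j]` over the closed point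
has a local ring that is a domain satisfying the per-stalk clause of the crux — then `X` has an F-injective
Macaulayfication in the sense of crux `FrobeniusLadder.FInjectiveMacaulayfication`: a proper birational `π : X' → X`
all of whose stalks are domains in which every system of parameters is weakly regular and generates a Frobenius
closed ideal (`p = 7`). Proof: `OfPointFixable.fInjectiveMacaulayfication_of_pointFixable` (A-loc) for
`X → Spec k`, with admissibility from affineness / finite type / `R` a domain, the Cohen–Macaulay binder from §1–§2,
and the non-F-injective locus inside `{𝔪}` by §1. [OURS · L1 W4.5a; cite: Fedder1983, Prop. 2.1; Matsumura1987,
Thm. 30.4 (ii), Thm. 17.4] -/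
theorem fInjectiveMacaulayfication_T11plus_char7 [CharP k 7] (Fs : Fin 2 → MvPolynomial (Fin 5) k)
    (hF₀ : Fs 0 = X 4 - X 1 ^ 2 - X 0 ^ 3) (hF₁ : Fs 1 = X 2 ^ 2 + X 4 ^ 3 + X 0 ^ 11 + X 3 ^ 7)
    (h0 : ∀ b : Spec (.of (MvPolynomial (Fin 5) k ⧸ Ideal.span (Set.range Fs))), b.asIdeal = Ideal.span (Set.range fun j : Fin 5 => Ideal.Quotient.mk (Ideal.span (Set.range Fs)) (X j)) →
      ∃ (n : ℕ) (c : Fin n → (Spec (.of (MvPolynomial (Fin 5) k ⧸ Ideal.span (Set.range Fs)))).presheaf.stalk b), Ideal.span (Set.range c) ≠ ⊥ ∧ (Ideal.span (Set.range c)).radical = IsLocalRing.maximalIdeal ((Spec (.of (MvPolynomial (Fin 5) k ⧸ Ideal.span (Set.range Fs)))).presheaf.stalk b) ∧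
        ∀ (j : Fin n) (𝔔 : PrimeSpectrum (Literature.AlgebraicGeometry.Resolution.blowupAlgebra (Ideal.span (Set.range c)) (c j))),
          𝔔.asIdeal.comap (algebraMap ((Spec (.of (MvPolynomial (Fin 5) k ⧸ Ideal.span (Set.range Fs)))).presheaf.stalk b) (Literature.AlgebraicGeometry.Resolution.blowupAlgebra (Ideal.span (Set.range c)) (c j))) = IsLocalRing.maximalIdeal ((Spec (.of (MvPolynomial (Fin 5) k ⧸ Ideal.span (Set.range Fs)))).presheaf.stalk b) →
          IsDomain (Localization.AtPrime 𝔔.asIdeal) ∧ ∀ d : ℕ, ringKrullDim (Localization.AtPrime 𝔔.asIdeal) = d → ∀ s : Fin d → Localization.AtPrime 𝔔.asIdeal, (Ideal.span (Set.range s)).radical.IsMaximal → RingTheory.Sequence.IsWeaklyRegular (Localization.AtPrime 𝔔.asIdeal) (List.ofFn s) ∧ ∀ y : Localization.AtPrime 𝔔.asIdeal, (∃ e : ℕ, y ^ 7 ^ e ∈ Ideal.span ((fun z : Localization.AtPrime 𝔔.asIdeal => z ^ 7 ^ e) '' (Ideal.span (Set.range s) : Set (Localization.AtPrime 𝔔.asIdeal))))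 → y ∈ Ideal.span (Set.range s)) :
        ∃ (X' : Scheme.{0}) (π : X' ⟶ (Spec (.of (MvPolynomial (Fin 5) k ⧸ Ideal.span (Set.range Fs))))), IsProper π ∧ Literature.AlgebraicGeometry.Resolution.IsBirational π ∧
      ∀ x : X', IsDomain (X'.presheaf.stalk x) ∧ ∀ d : ℕ, ringKrullDim (X'.presheaf.stalk x) = d → ∀ s : Fin d → X'.presheaf.stalk x, (Ideal.span (Set.range s)).radical.IsMaximal → RingTheory.Sequence.IsWeaklyRegular (X'.presheaf.stalk x) (List.ofFn s) ∧ ∀ y : X'.presheaf.stalk x, (∃ e : ℕ, y ^ 7 ^ e ∈ Ideal.span ((fun z : X'.presheaf.stalk x => z ^ 7 ^ e) '' (Ideal.span (Set.range s) : Set (X'.presheaf.stalk x)))) → y ∈ Ideal.span (Set.range s) := by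
  haveI : Fact (Nat.Prime 7) := ⟨by norm_num⟩
  have hprime := T11PlusPrime.t11plus_prime_and_X_ne_zero k Fs hF₀ hF₁
  haveI : (Ideal.span (Set.range Fs)).IsPrime := hprime.1
  haveI : IsDomain (MvPolynomial (Fin 5) k ⧸ Ideal.span (Set.range Fs)) := Ideal.Quotient.isDomain _
  -- the origin is a maximal ideal
  have h𝔪 : (Ideal.span (Set.range fun j : Fin 5 => Ideal.Quotient.mk (Ideal.span (Set.range Fs)) (X j))).IsMaximal := by
    have hmap : Ideal.span (Set.range fun j : Fin 5 => Ideal.Quotient.mk (Ideal.span (Set.range Fs)) (X j)) =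
        (Ideal.span (Set.range (X : Fin 5 → MvPolynomial (Fin 5) k))).map (Ideal.Quotient.mk (Ideal.span (Set.range Fs))) := by
      rw [Ideal.map_span, ← Set.range_comp]; rfl
    rw [hmap]
    refine (Ideal.map_eq_top_or_isMaximal_of_surjective _ Ideal.Quotient.mk_surjective
      (Fedder.isMaximal_span_range_X k 5)).resolve_left fun htop => ?_
    have hX : ∀ j : Fin 5, (X j : MvPolynomial (Fin 5) k) ∈
        Ideal.span (Set.range (X : Fin 5 → MvPolynomial (Fin 5) k)) :=
      fun j => Ideal.subset_span (Set.mem_range_self j)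
    have hle : Ideal.span (Set.range Fs) ≤ Ideal.span (Set.range (X : Fin 5 → MvPolynomial (Fin 5) k)) := by
      rw [Ideal.span_le]
      rintro _ ⟨i, rfl⟩
      fin_cases i
      · change Fs 0 ∈ _
        rw [hF₀]
        exact sub_mem (sub_mem (hX 4) (Ideal.pow_mem_of_mem _ (hX 1) 2 (by norm_num)))
          (Ideal.pow_mem_of_mem _ (hX 0) 3 (by norm_num))
      · change Fs 1 ∈ _
        rw [hF₁]
        exact add_mem (add_mem (add_mem (Ideal.pow_mem_of_mem _ (hX 2) 2 (by norm_num))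
          (Ideal.pow_mem_of_mem _ (hX 4) 3 (by norm_num))) (Ideal.pow_mem_of_mem _ (hX 0) 11 (by norm_num)))
          (Ideal.pow_mem_of_mem _ (hX 3) 7 (by norm_num))
    have h := Ideal.comap_map_of_surjective (Ideal.Quotient.mk (Ideal.span (Set.range Fs))) Ideal.Quotient.mk_surjective
      (Ideal.span (Set.range (X : Fin 5 → MvPolynomial (Fin 5) k)))
    rw [htop, Ideal.comap_top, ← RingHom.ker_eq_comap_bot, Ideal.mk_ker, sup_eq_left.mpr hle] at h
    exact (Fedder.isMaximal_span_range_X k 5).ne_top h.symm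
  -- primes other than the origin miss a variable
  have hne : ∀ P : Ideal (MvPolynomial (Fin 5) k ⧸ Ideal.span (Set.range Fs)), P.IsPrime → P ≠ Ideal.span (Set.range fun j : Fin 5 => Ideal.Quotient.mk (Ideal.span (Set.range Fs)) (X j)) →
      ∃ j : Fin 5, Ideal.Quotient.mk (Ideal.span (Set.range Fs)) (X j) ∉ P := by
    intro P hP hPne
    by_contra hcon
    push Not at hcon
    apply hPne
    refine (h𝔪.eq_of_le hP.ne_top ?_).symm
    rw [Ideal.span_le]
    rintro _ ⟨j, rfl⟩
    exact hcon j
  have hrange : Set.range Fs = {r : MvPolynomial (Fin 5) k | r ∈ [Fs 0, Fs 1]} := by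
    ext r
    simp only [Set.mem_range, Set.mem_setOf_eq, List.mem_cons, List.not_mem_nil, or_false]
    constructor
    · rintro ⟨i, rfl⟩
      fin_cases i
      · exact Or.inl rfl
      · exact Or.inr rfl
    · rintro (rfl | rfl)
      exacts [⟨0, rfl⟩, ⟨1, rfl⟩]
  -- the structure morphism `Spec R → Spec k` and its admissibility
  let f₁ : Spec (.of (MvPolynomial (Fin 5) k ⧸ Ideal.span (Set.range Fs))) ⟶ Spec (.of k) := Spec.map (CommRingCat.ofHom (algebraMap k (MvPolynomial (Fin 5) k ⧸ Ideal.span (Set.range Fs))))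
  have hft : LocallyOfFiniteType f₁ :=
    (HasRingHomProperty.Spec_iff (P := @LocallyOfFiniteType)).mpr (RingHom.finiteType_algebraMap.mpr inferInstance)
  have hsep : IsSeparated f₁ := inferInstance
  have hqc : QuasiCompact f₁ := inferInstance
  have hint : IsIntegral (Spec (.of (MvPolynomial (Fin 5) k ⧸ Ideal.span (Set.range Fs)))) := inferInstance
  -- stalks of `Spec R` are the localizations
  have e : ∀ x : Spec (.of (MvPolynomial (Fin 5) k ⧸ Ideal.span (Set.range Fs))),
      (Spec (.of (MvPolynomial (Fin 5) k ⧸ Ideal.span (Set.range Fs)))).presheaf.stalk x ≃+* Localization.AtPrime x.asIdeal :=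
    fun x => (Spec.stalkIso (.of (MvPolynomial (Fin 5) k ⧸ Ideal.span (Set.range Fs))) x).commRingCatIsoToRingEquiv
  -- the clause on the stalks off the origin
  have hfull := fun (x : Spec (.of (MvPolynomial (Fin 5) k ⧸ Ideal.span (Set.range Fs)))) (hx : x.asIdeal ≠ Ideal.span (Set.range fun j : Fin 5 => Ideal.Quotient.mk (Ideal.span (Set.range Fs)) (X j))) =>
    DegreeZeroDescent.inlineClause_of_ringEquiv (L := Localization.AtPrime x.asIdeal)
      (L' := (Spec (.of (MvPolynomial (Fin 5) k ⧸ Ideal.span (Set.range Fs)))).presheaf.stalk x) 7 (e x).symm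
      (fiClause_atPrime_of_ne_origin k Fs hF₀ hF₁ x.asIdeal (hne x.asIdeal x.2 hx)).2
  refine OfPointFixable.fInjectiveMacaulayfication_of_pointFixable 7 (by norm_num) k (Spec (.of (MvPolynomial (Fin 5) k ⧸ Ideal.span (Set.range Fs)))) f₁ hsep hft hqc
    hint ?_ ?_ ?_
  · -- every stalk is Cohen–Macaulay
    intro x
    by_cases hx : x.asIdeal = Ideal.span (Set.range fun j : Fin 5 => Ideal.Quotient.mk (Ideal.span (Set.range Fs)) (X j))
    · have hQ : x.asIdeal.IsMaximal := hx ▸ h𝔪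
      exact FiLocusOpenOfAffine.cmClause_of_ringEquiv (A := Localization.AtPrime x.asIdeal)
        (B := (Spec (.of (MvPolynomial (Fin 5) k ⧸ Ideal.span (Set.range Fs)))).presheaf.stalk x) (e x).symm
        (cmClause_of_isMaximal (Fs 0) (Fs 1) hF₀ hF₁ (Set.range Fs) hrange x.asIdeal hQ)
    · exact fun d hd s hs => (hfull x hx d hd s hs).1
  · -- the non-F-injective locus is inside the origin
    refine (Set.finite_singleton (⟨Ideal.span (Set.range fun j : Fin 5 => Ideal.Quotient.mk (Ideal.span (Set.range Fs)) (X j)), h𝔪.isPrime⟩ : Spec (.of (MvPolynomial (Fin 5) k ⧸ Ideal.span (Set.range Fs))))).subset fun x hx => ?_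
    refine Set.mem_singleton_iff.mpr ?_
    by_contra hxne
    have hx' : x.asIdeal ≠ Ideal.span (Set.range fun j : Fin 5 => Ideal.Quotient.mk (Ideal.span (Set.range Fs)) (X j)) := fun h => hxne (PrimeSpectrum.ext h)
    exact hx fun d hd s hs => (hfull x hx' d hd s hs).2
  · -- point-fixability at the (only possible) bad point
    intro b hb
    apply h0 b
    by_contra hb'
    exact hb fun d hd s hs => (hfull b hb' d hd s hs).2

end Summit.ResolutionOfSingularities.ResolutionOfSingularities.Theorems.FInjectiveMacaulayfication.T11SpecimenDoor
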